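import Literature.NumberTheory.Automorphic.UnitaryRankTwoDepthValueLaw              -- ★ A-p13: normal-form elements, VALUE LAW over LEMMA U
import Literature.NumberTheory.Automorphic.SelfDualStableLatticeDepthCountCMExact     -- ★ A-p13 FILES 1–5: depth counts at `w`
import Literature.NumberTheory.Automorphic.OrbitalIntegralDepthExpansion               -- ★ F0P2-p01 (α) L1: `finsum_mem_eq_ncard_smul_add_sum_ncard_smul`
import Literature.NumberTheory.Automorphic.FixedCosetsStableLatticesSep                -- ★ F0P2-p01 L2a: `ncard_sep_fixedBy_unitary_eq_ncard`, `injOn_span_out_unitary`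
import Literature.NumberTheory.Automorphic.FixedPointsQuotientFibration                -- ★ B-p04: `inv_mul_mul_mem_of_smul_eq`
import HarnessLib

/-!
# (α) LAYER 2-B — THE DEPTH EXPANSION of `Σ_{q ∈ Fix_γ(U⧸K⁰)} φ(q.out⁻¹ γ q.out)` for an elliptic regular `γ ∈ U(σ_w, (Φ₂)_w)(L_w)` at an inert place: the counts are the
# tree-ball ∕ sphere numbers `Σ_{j ≤ n, j ≡ e, j + m ≤ n} w(q_v, j)` and `[i ≤ n ∧ n − i ≡ e]·w(q_v, n − i)`, the values are `φ(u₁·1)` and `φ(u₁(1 + ϖ^i N_δ))`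
(Rogawski 1990 §4.9 Lemma 4.9.3; Labesse–Langlands 1979 §2 — road «R1LL-tree», architect A-p16 (g27) RULINGS A-8 (c), A-13 (a), A-14 (a))

Topic `NumberTheory/Rogawski1990` (the road's namespace for the CM assembly is `Literature.NumberTheory.Automorphic.UnitaryGroup`, that of ★ FILES 4–5).  THEOREMS ONLY (no
definition, no instance, no notation, no named fact, no `sorry`).  Cell `pub/hodgecm-mathlib`, F0∕P3a road «R1LL-tree», hand A-p13 (g31).  HC_CM is proved only modulo the printed
citations until rung 0 closes; nothing printed is asserted here.

THE STATEMENT (A-13 (a) shape, measure-free, finsum level, carrier literally `↥(unitaryGroupOfForm σ_w (placeForm Φ₂ w.1))` (A-14 (a) pin), `K⁰ = U ∩ GL₂(𝒪_w)` as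
`(glInt 2 L_w).subgroupOf U`): for `γ ∈ U` with eigenframe `↑γ P = P · diag(u)` (`u₀ ≠ u₁` of norm one, `v(u₀ − u₁) = v(ϖ_w)^n`), `m ≤ n`, `Km ≤ U` DATA with the entrywise
membership `(∀ r s, ϖ_w^{−m}(↑y − 1) r s ∈ 𝒪) → y ∈ Km`, and `φ : U → E` invariant under `Ad K⁰` and right-`Km`:
**`finsum_fixedBy_conj_eq_depthExpansion_at`** — `∃ e ≤ 1, (Even (log v ⟨p₀,p₀⟩) ↔ e = 0) ∧ ∃ xm x, ↑xm = u₁ • 1 ∧ (∀ i, ↑(x i) = u₁ • (1 + ϖ_w^i • N_δ)) ∧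
Σᶠ_{q ∈ Fix_γ(U⧸K⁰)} φ(q.out⁻¹ γ q.out) = (Σ_{j ∈ range (n+1), j % 2 = e ∧ j + m ≤ n} w_j) • φ xm + Σ_{i < m} [i ≤ n ∧ (n − i) % 2 = e]·w_{n−i} • φ (x i)`,
`w_0 = 1`, `w_j = q_v^{j−1}(q_v + 1)`, `δ = σO a₀ − a₀` (★ FILE 4 package).  ROUTE: ★ (α) L1 regrouping with the depth `d q := Nat.findGreatest (level predicate of
`q.out⁻¹ γ q.out` at `u₁`) n`; the VALUE LAW ★ `apply_eq_apply_scalar_of_depth_le` ∕ `apply_eq_apply_normalForm_of_depth_eq` (LEMMA U ★ p843178); the counts through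
★ L2a `ncard_sep_fixedBy_unitary_eq_ncard`, ★ lattice token `map_sub_smul_one_le_iff_forall_mem`, ★ docking `exists_mem_unitary_span_eq_iff_selfDual_of_nonsplit`, and
★ FILES 4–5 `exists_ncard_selfDualStable_antidiagTwo_{level_eq_sum,depth_eq_ite}_at` (the parity bits agree, being characterised by the same frame invariant).
The `K¹` (second vertex type) twin is a TRANSPORT of this head by the similitude `diag(1, ϖ_w)` (RULING A-14 (b), B-p10 (g26)).

## References
* [Rogawski1990] J. D. Rogawski, *Automorphic Representations of Unitary Groups in Three Variables* (1990), §4.9 Lemma 4.9.3 p. 56.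
* [LabesseLanglands1979] J.-P. Labesse, R. P. Langlands, *L-indistinguishability for SL(2)*, Canad. J. Math. 31 (1979), §2.
* [Kottwitz1988] R. E. Kottwitz, *Tamagawa numbers*, Ann. of Math. 127 (1988), §2.
-/

set_option autoImplicit false

noncomputable section

open NumberField IsDedekindDomain Matrix Finset ValuativeRel
open scoped ValuativeRel Matrix MatrixGroups

namespace Literature.NumberTheory.Automorphic

/-! ## §0 Bookkeeping: `Nat.findGreatest` of an antitone predicate; uniqueness of the parity bit -/

section FindGreatest

variable {P : ℕ → Prop} [DecidablePred P]

/-- For an antitone predicate with `P 0`: `m ≤ findGreatest P n ↔ P m` (`m ≤ n`). [cite: Rogawski1990, §4.9 p. 54] -/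
theorem le_findGreatest_iff_of_anti (hanti : ∀ i j, i ≤ j → P j → P i) (h0 : P 0) {m n : ℕ} (hmn : m ≤ n) :
    m ≤ Nat.findGreatest P n ↔ P m := by
  refine ⟨fun h => hanti _ _ h ?_, Nat.le_findGreatest hmn⟩
  by_cases hd : Nat.findGreatest P n = 0
  · rw [hd]; exact h0
  · exact Nat.findGreatest_of_ne_zero rfl hd

/-- For an antitone predicate with `P 0`: `findGreatest P n = i ↔ P i ∧ ¬ P (i+1)` (`i < n`). [cite: Rogawski1990, §4.9 p. 54] -/
theorem findGreatest_eq_iff_of_anti (hanti : ∀ i j, i ≤ j → P j → P i) (h0 : P 0) {i n : ℕ} (hin : i < n) :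
    Nat.findGreatest P n = i ↔ P i ∧ ¬ P (i + 1) := by
  constructor
  · intro h
    refine ⟨(le_findGreatest_iff_of_anti hanti h0 hin.le).1 h.ge, Nat.findGreatest_is_greatest (by rw [h]; exact Nat.lt_succ_self i) (by omega)⟩
  · rintro ⟨hi, hi1⟩
    exact Nat.findGreatest_eq_iff.2 ⟨hin.le, fun _ => hi, fun k hik hkn hk => hi1 (hanti _ _ (by omega) hk)⟩

/-- Two bits `≤ 1` with the same characterisation coincide. [folklore] -/
private theorem eq_of_iff_eq_zero_of_le_one {X : Prop} {e e' : ℕ} (he : e ≤ 1) (he' : e' ≤ 1) (h : X ↔ e = 0) (h' : X ↔ e' = 0) : e' = e := by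
  by_cases hX : X
  · rw [h.1 hX, h'.1 hX]
  · have h1 := mt h.2 hX; have h2 := mt h'.2 hX; omega

/-- Same with the flipped characterisation on one side reading `e = 1`. [folklore] -/
private theorem eq_of_iff_eq_one_of_le_one {X : Prop} {e e' : ℕ} (he : e ≤ 1) (he' : e' ≤ 1) (h : X ↔ e = 1) (h' : X ↔ e' = 1) : e' = e := by
  by_cases hX : X
  · rw [h.1 hX, h'.1 hX]
  · have h1 := mt h.2 hX; have h2 := mt h'.2 hX; omega

end FindGreatest

end Literature.NumberTheory.Automorphic

namespace Literature.NumberTheory.Automorphic.UnitaryGroup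

open Literature.NumberTheory.Rogawski1990 Literature.NumberTheory.GaloisRepresentations

variable (L : Type) [Field L] [NumberField L] [IsCMField L] (v : HeightOneSpectrum (𝓞 ↥(maximalRealSubfield L)))
  (w : PlacesOver L v) (hw : IsCMField.complexConj L • w.1 = w.1)

/-! ## §1 The one-place carrier `U = U(σ_w, (Φ₂)_w)`: the literal form, fixed cosets, finiteness, counts -/

section Carrier

omit [IsCMField L] in
/-- **`(Φ₂)_w = [[0,1],[1,0]]` literally** (★ `placeForm_antidiagOne`, ★ `antidiagOne_eq_over`). [cite: Rogawski1990, §3.5 p. 29] -/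
theorem placeForm_antidiagTwo_eq_swap_lit :
    placeForm (Matrix.of fun i j : Fin 2 => if i.val + j.val + 1 = 2 then (1 : L) else 0) w.1 = !![0, 1; 1, 0] := by
  rw [placeForm_antidiagOne, ← antidiagOne_eq_over]
  ext i j
  fin_cases i <;> fin_cases j <;> simp [Matrix.of_apply]

include hw in
/-- `σ_w δ = −δ` for `δ = σO a₀ − a₀` (`σO` the restriction of `σ_w` to `𝒪`, an involution). [cite: Jacobowitz1962, §4] -/
theorem galAdicCompletionMap_delta_eq_neg (σO : 𝒪[w.1.adicCompletion L] →+* 𝒪[w.1.adicCompletion L])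
    (hσO' : ∀ x : 𝒪[w.1.adicCompletion L], ((σO x : 𝒪[w.1.adicCompletion L]) : w.1.adicCompletion L) = galAdicCompletionMap (L := L) (IsCMField.complexConj L) hw x)
    (hσσ : ∀ x, σO (σO x) = x) (a₀ : 𝒪[w.1.adicCompletion L]) :
    galAdicCompletionMap (L := L) (IsCMField.complexConj L) hw ((σO a₀ - a₀ : 𝒪[w.1.adicCompletion L]) : w.1.adicCompletion L) = -((σO a₀ - a₀ : 𝒪[w.1.adicCompletion L]) : w.1.adicCompletion L) := by
  have _hw := hw
  have h1 : galAdicCompletionMap (L := L) (IsCMField.complexConj L) hw ((σO a₀ : 𝒪[w.1.adicCompletion L]) : w.1.adicCompletion L) = ((a₀ : 𝒪[w.1.adicCompletion L]) : w.1.adicCompletion L) := by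
    rw [← hσO', hσσ]
  have h2 : galAdicCompletionMap (L := L) (IsCMField.complexConj L) hw ((a₀ : 𝒪[w.1.adicCompletion L]) : w.1.adicCompletion L) = ((σO a₀ : 𝒪[w.1.adicCompletion L]) : w.1.adicCompletion L) := (hσO' a₀).symm
  push_cast
  rw [map_sub, h1, h2]
  ring

/-- **A fixed coset reads `γ` integrally**: `q ∈ Fix_γ(U ⧸ K⁰) ⇒ q.out⁻¹ γ q.out ∈ K⁰` (`γ · q = q` unfolded). [cite: Kottwitz1988, §2] -/
theorem coe_conj_out_mem_glInt_of_mem_fixedBy (γ : ↥(unitaryGroupOfForm (galAdicCompletionMap (L := L) (IsCMField.complexConj L) hw) (placeForm (Matrix.of fun i j : Fin 2 => if i.val + j.val + 1 = 2 then (1 : L) else 0) w.1)))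
    (q : ↥(unitaryGroupOfForm (galAdicCompletionMap (L := L) (IsCMField.complexConj L) hw) (placeForm (Matrix.of fun i j : Fin 2 => if i.val + j.val + 1 = 2 then (1 : L) else 0) w.1)) ⧸
        (glInt 2 (w.1.adicCompletion L)).subgroupOf (unitaryGroupOfForm (galAdicCompletionMap (L := L) (IsCMField.complexConj L) hw) (placeForm (Matrix.of fun i j : Fin 2 => if i.val + j.val + 1 = 2 then (1 : L) else 0) w.1)))
    (hq : q ∈ MulAction.fixedBy (↥(unitaryGroupOfForm (galAdicCompletionMap (L := L) (IsCMField.complexConj L) hw) (placeForm (Matrix.of fun i j : Fin 2 => if i.val + j.val + 1 = 2 then (1 : L) else 0) w.1)) ⧸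
        (glInt 2 (w.1.adicCompletion L)).subgroupOf (unitaryGroupOfForm (galAdicCompletionMap (L := L) (IsCMField.complexConj L) hw) (placeForm (Matrix.of fun i j : Fin 2 => if i.val + j.val + 1 = 2 then (1 : L) else 0) w.1))) γ) :
    (((q.out⁻¹ * γ * q.out : ↥(unitaryGroupOfForm (galAdicCompletionMap (L := L) (IsCMField.complexConj L) hw) (placeForm (Matrix.of fun i j : Fin 2 => if i.val + j.val + 1 = 2 then (1 : L) else 0) w.1)))) : GL (Fin 2) (w.1.adicCompletion L)) ∈ glInt 2 (w.1.adicCompletion L) := by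
  exact (Subgroup.mem_subgroupOf).1 (inv_mul_mul_mem_of_smul_eq Quotient.out QuotientGroup.out_eq' γ hq)

-- `L_w`-sized statements: elaboration budget only (no search)
set_option maxHeartbeats 800000 in
include hw in
/-- **`Fix_γ(U ⧸ K⁰)` IS FINITE** for `γ` elliptic regular (`q ↦ Λ(q.out)` is injective ★ L2a with image inside the finite set of `γ`-stable self-dual lattices,
★ docking + ★ FILE 4 `finite_selfDualStable_antidiagTwo_at`). [cite: Kottwitz1988, §2] [cite: Rogawski1990, §4.9 p. 54] -/
theorem finite_fixedBy_quotient_glInt_at (hunr : Algebra.IsUnramifiedIn (𝓞 L) v.asIdeal)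
    {γ : ↥(unitaryGroupOfForm (galAdicCompletionMap (L := L) (IsCMField.complexConj L) hw) (placeForm (Matrix.of fun i j : Fin 2 => if i.val + j.val + 1 = 2 then (1 : L) else 0) w.1))} {P : GL (Fin 2) (w.1.adicCompletion L)} {u : Fin 2 → w.1.adicCompletion L}
    (hP : (((γ : ↥(unitaryGroupOfForm (galAdicCompletionMap (L := L) (IsCMField.complexConj L) hw) (placeForm (Matrix.of fun i j : Fin 2 => if i.val + j.val + 1 = 2 then (1 : L) else 0) w.1))) : GL (Fin 2) (w.1.adicCompletion L)) : Matrix (Fin 2) (Fin 2) (w.1.adicCompletion L)) * P = P * diagonal u) (hu : Function.Injective u)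
    (hu1 : ∀ i, galAdicCompletionMap (L := L) (IsCMField.complexConj L) hw (u i) * u i = 1) {n : ℕ}
    (hN : valuation (w.1.adicCompletion L) (u 0 - u 1) = valuation (w.1.adicCompletion L) (toPlace v w (HeckeCharacter.uniformizer ↥(maximalRealSubfield L) v : v.adicCompletion ↥(maximalRealSubfield L)) ^ n)) :
    (MulAction.fixedBy (↥(unitaryGroupOfForm (galAdicCompletionMap (L := L) (IsCMField.complexConj L) hw) (placeForm (Matrix.of fun i j : Fin 2 => if i.val + j.val + 1 = 2 then (1 : L) else 0) w.1)) ⧸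
        (glInt 2 (w.1.adicCompletion L)).subgroupOf (unitaryGroupOfForm (galAdicCompletionMap (L := L) (IsCMField.complexConj L) hw) (placeForm (Matrix.of fun i j : Fin 2 => if i.val + j.val + 1 = 2 then (1 : L) else 0) w.1))) γ).Finite := by
  classical
  have hfinS := finite_selfDualStable_antidiagTwo_at L v w hw hunr (γ := (γ : GL (Fin 2) (w.1.adicCompletion L))) γ.2 hP hu hu1 hN
  have himg : (fun q : ↥(unitaryGroupOfForm (galAdicCompletionMap (L := L) (IsCMField.complexConj L) hw) (placeForm (Matrix.of fun i j : Fin 2 => if i.val + j.val + 1 = 2 then (1 : L) else 0) w.1)) ⧸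
        (glInt 2 (w.1.adicCompletion L)).subgroupOf (unitaryGroupOfForm (galAdicCompletionMap (L := L) (IsCMField.complexConj L) hw) (placeForm (Matrix.of fun i j : Fin 2 => if i.val + j.val + 1 = 2 then (1 : L) else 0) w.1)) =>
      Submodule.span 𝒪[w.1.adicCompletion L] (Set.range ((((q.out : ↥(unitaryGroupOfForm (galAdicCompletionMap (L := L) (IsCMField.complexConj L) hw) (placeForm (Matrix.of fun i j : Fin 2 => if i.val + j.val + 1 = 2 then (1 : L) else 0) w.1))) : GL (Fin 2) (w.1.adicCompletion L)) : Matrix (Fin 2) (Fin 2) (w.1.adicCompletion L)))ᵀ)) ''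
        {q ∈ MulAction.fixedBy (↥(unitaryGroupOfForm (galAdicCompletionMap (L := L) (IsCMField.complexConj L) hw) (placeForm (Matrix.of fun i j : Fin 2 => if i.val + j.val + 1 = 2 then (1 : L) else 0) w.1)) ⧸
        (glInt 2 (w.1.adicCompletion L)).subgroupOf (unitaryGroupOfForm (galAdicCompletionMap (L := L) (IsCMField.complexConj L) hw) (placeForm (Matrix.of fun i j : Fin 2 => if i.val + j.val + 1 = 2 then (1 : L) else 0) w.1))) γ | True} =
      {Λ : Submodule 𝒪[w.1.adicCompletion L] (Fin 2 → w.1.adicCompletion L) |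
        (∃ u ∈ unitaryGroupOfForm (galAdicCompletionMap (L := L) (IsCMField.complexConj L) hw) (placeForm (Matrix.of fun i j : Fin 2 => if i.val + j.val + 1 = 2 then (1 : L) else 0) w.1),
          Λ = Submodule.span 𝒪[w.1.adicCompletion L] (Set.range ((u : Matrix (Fin 2) (Fin 2) (w.1.adicCompletion L)))ᵀ)) ∧
          Λ.map ((Matrix.toLin' ((((γ : ↥(unitaryGroupOfForm (galAdicCompletionMap (L := L) (IsCMField.complexConj L) hw) (placeForm (Matrix.of fun i j : Fin 2 => if i.val + j.val + 1 = 2 then (1 : L) else 0) w.1))) : GL (Fin 2) (w.1.adicCompletion L)) : Matrix (Fin 2) (Fin 2) (w.1.adicCompletion L)))).restrictScalars 𝒪[w.1.adicCompletion L]) = Λ ∧ True} :=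
    image_sep_fixedBy_unitary_eq (galAdicCompletionMap (L := L) (IsCMField.complexConj L) hw) (isUnit_placeForm_antidiagOne (E := L) 2 w.1).unit γ (fun _ => True)
  have hsep : {q ∈ MulAction.fixedBy (↥(unitaryGroupOfForm (galAdicCompletionMap (L := L) (IsCMField.complexConj L) hw) (placeForm (Matrix.of fun i j : Fin 2 => if i.val + j.val + 1 = 2 then (1 : L) else 0) w.1)) ⧸
        (glInt 2 (w.1.adicCompletion L)).subgroupOf (unitaryGroupOfForm (galAdicCompletionMap (L := L) (IsCMField.complexConj L) hw) (placeForm (Matrix.of fun i j : Fin 2 => if i.val + j.val + 1 = 2 then (1 : L) else 0) w.1))) γ | True} = MulAction.fixedBy (↥(unitaryGroupOfForm (galAdicCompletionMap (L := L) (IsCMField.complexConj L) hw) (placeForm (Matrix.of fun i j : Fin 2 => if i.val + j.val + 1 = 2 then (1 : L) else 0) w.1)) ⧸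
        (glInt 2 (w.1.adicCompletion L)).subgroupOf (unitaryGroupOfForm (galAdicCompletionMap (L := L) (IsCMField.complexConj L) hw) (placeForm (Matrix.of fun i j : Fin 2 => if i.val + j.val + 1 = 2 then (1 : L) else 0) w.1))) γ := by
    ext q; simp only [Set.mem_setOf_eq, and_true]
  rw [hsep] at himg
  refine Set.Finite.of_finite_image (s := MulAction.fixedBy (↥(unitaryGroupOfForm (galAdicCompletionMap (L := L) (IsCMField.complexConj L) hw) (placeForm (Matrix.of fun i j : Fin 2 => if i.val + j.val + 1 = 2 then (1 : L) else 0) w.1)) ⧸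
        (glInt 2 (w.1.adicCompletion L)).subgroupOf (unitaryGroupOfForm (galAdicCompletionMap (L := L) (IsCMField.complexConj L) hw) (placeForm (Matrix.of fun i j : Fin 2 => if i.val + j.val + 1 = 2 then (1 : L) else 0) w.1))) γ)
    (f := fun q : ↥(unitaryGroupOfForm (galAdicCompletionMap (L := L) (IsCMField.complexConj L) hw) (placeForm (Matrix.of fun i j : Fin 2 => if i.val + j.val + 1 = 2 then (1 : L) else 0) w.1)) ⧸
        (glInt 2 (w.1.adicCompletion L)).subgroupOf (unitaryGroupOfForm (galAdicCompletionMap (L := L) (IsCMField.complexConj L) hw) (placeForm (Matrix.of fun i j : Fin 2 => if i.val + j.val + 1 = 2 then (1 : L) else 0) w.1)) =>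
      Submodule.span 𝒪[w.1.adicCompletion L] (Set.range ((((q.out : ↥(unitaryGroupOfForm (galAdicCompletionMap (L := L) (IsCMField.complexConj L) hw) (placeForm (Matrix.of fun i j : Fin 2 => if i.val + j.val + 1 = 2 then (1 : L) else 0) w.1))) : GL (Fin 2) (w.1.adicCompletion L)) : Matrix (Fin 2) (Fin 2) (w.1.adicCompletion L)))ᵀ)) ?_
    (injOn_span_out_unitary (galAdicCompletionMap (L := L) (IsCMField.complexConj L) hw) (isUnit_placeForm_antidiagOne (E := L) 2 w.1).unit _)
  rw [himg]
  refine hfinS.subset fun Λ hΛ => ?_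
  obtain ⟨hU, hstab, -⟩ := hΛ
  exact ⟨(exists_mem_unitary_span_eq_iff_selfDual_of_nonsplit L 2 _ (IsCMField.complexConj_ne_one L) w hw hunr (antidiagOne_isHermitian L 2)
    (isUnit_placeForm_antidiagOne (E := L) 2 w.1) (unit_placeForm_antidiagOne_mem_glInt (E := L) 2 w.1) Λ).1 hU, hstab⟩

set_option maxHeartbeats 800000 in
include hw in
/-- **COSET COUNTS ARE LATTICE COUNTS, under any predicate**: if `Y q ↔ X Λ(q.out)` on cosets then
`#{q ∈ Fix_γ(U⧸K⁰) | Y q} = #{Λ ∈ S((Φ₂)_w, γ) | X Λ}` (★ L2a `ncard_sep_fixedBy_unitary_eq_ncard` + ★ docking). [cite: Kottwitz1988, §2] [cite: Rogawski1990, §4.9 p. 54] -/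
theorem ncard_sep_fixedBy_eq_ncard_selfDualStable_sep_at (hunr : Algebra.IsUnramifiedIn (𝓞 L) v.asIdeal) (γ : ↥(unitaryGroupOfForm (galAdicCompletionMap (L := L) (IsCMField.complexConj L) hw) (placeForm (Matrix.of fun i j : Fin 2 => if i.val + j.val + 1 = 2 then (1 : L) else 0) w.1)))
    (X : Submodule 𝒪[w.1.adicCompletion L] (Fin 2 → w.1.adicCompletion L) → Prop)
    (Y : (↥(unitaryGroupOfForm (galAdicCompletionMap (L := L) (IsCMField.complexConj L) hw) (placeForm (Matrix.of fun i j : Fin 2 => if i.val + j.val + 1 = 2 then (1 : L) else 0) w.1)) ⧸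
        (glInt 2 (w.1.adicCompletion L)).subgroupOf (unitaryGroupOfForm (galAdicCompletionMap (L := L) (IsCMField.complexConj L) hw) (placeForm (Matrix.of fun i j : Fin 2 => if i.val + j.val + 1 = 2 then (1 : L) else 0) w.1))) → Prop)
    (hXY : ∀ q ∈ MulAction.fixedBy (↥(unitaryGroupOfForm (galAdicCompletionMap (L := L) (IsCMField.complexConj L) hw) (placeForm (Matrix.of fun i j : Fin 2 => if i.val + j.val + 1 = 2 then (1 : L) else 0) w.1)) ⧸
        (glInt 2 (w.1.adicCompletion L)).subgroupOf (unitaryGroupOfForm (galAdicCompletionMap (L := L) (IsCMField.complexConj L) hw) (placeForm (Matrix.of fun i j : Fin 2 => if i.val + j.val + 1 = 2 then (1 : L) else 0) w.1))) γ,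
      Y q ↔ X (Submodule.span 𝒪[w.1.adicCompletion L] (Set.range ((((q.out : ↥(unitaryGroupOfForm (galAdicCompletionMap (L := L) (IsCMField.complexConj L) hw) (placeForm (Matrix.of fun i j : Fin 2 => if i.val + j.val + 1 = 2 then (1 : L) else 0) w.1))) : GL (Fin 2) (w.1.adicCompletion L)) : Matrix (Fin 2) (Fin 2) (w.1.adicCompletion L)))ᵀ))) :
    {q ∈ MulAction.fixedBy (↥(unitaryGroupOfForm (galAdicCompletionMap (L := L) (IsCMField.complexConj L) hw) (placeForm (Matrix.of fun i j : Fin 2 => if i.val + j.val + 1 = 2 then (1 : L) else 0) w.1)) ⧸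
        (glInt 2 (w.1.adicCompletion L)).subgroupOf (unitaryGroupOfForm (galAdicCompletionMap (L := L) (IsCMField.complexConj L) hw) (placeForm (Matrix.of fun i j : Fin 2 => if i.val + j.val + 1 = 2 then (1 : L) else 0) w.1))) γ | Y q}.ncard =
      {Λ : Submodule 𝒪[w.1.adicCompletion L] (Fin 2 → w.1.adicCompletion L) |
          ((∃ g : GL (Fin 2) (w.1.adicCompletion L),
            (∃ J' ∈ glInt 2 (w.1.adicCompletion L), (J' : Matrix (Fin 2) (Fin 2) (w.1.adicCompletion L)) =
              formCongr (galAdicCompletionMap (L := L) (IsCMField.complexConj L) hw) g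
                (placeForm (Matrix.of fun i j : Fin 2 => if i.val + j.val + 1 = 2 then (1 : L) else 0) w.1)) ∧
            Λ = Submodule.span 𝒪[w.1.adicCompletion L] (Set.range ((g : Matrix (Fin 2) (Fin 2) (w.1.adicCompletion L)))ᵀ)) ∧
          Λ.map ((Matrix.toLin' (((γ : ↥(unitaryGroupOfForm (galAdicCompletionMap (L := L) (IsCMField.complexConj L) hw) (placeForm (Matrix.of fun i j : Fin 2 => if i.val + j.val + 1 = 2 then (1 : L) else 0) w.1))) : GL (Fin 2) (w.1.adicCompletion L)) : Matrix (Fin 2) (Fin 2) (w.1.adicCompletion L))).restrictScalars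
            𝒪[w.1.adicCompletion L]) = Λ) ∧
          X Λ}.ncard := by
  have hsep : {q ∈ MulAction.fixedBy (↥(unitaryGroupOfForm (galAdicCompletionMap (L := L) (IsCMField.complexConj L) hw) (placeForm (Matrix.of fun i j : Fin 2 => if i.val + j.val + 1 = 2 then (1 : L) else 0) w.1)) ⧸
        (glInt 2 (w.1.adicCompletion L)).subgroupOf (unitaryGroupOfForm (galAdicCompletionMap (L := L) (IsCMField.complexConj L) hw) (placeForm (Matrix.of fun i j : Fin 2 => if i.val + j.val + 1 = 2 then (1 : L) else 0) w.1))) γ | Y q} =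
      {q ∈ MulAction.fixedBy (↥(unitaryGroupOfForm (galAdicCompletionMap (L := L) (IsCMField.complexConj L) hw) (placeForm (Matrix.of fun i j : Fin 2 => if i.val + j.val + 1 = 2 then (1 : L) else 0) w.1)) ⧸
        (glInt 2 (w.1.adicCompletion L)).subgroupOf (unitaryGroupOfForm (galAdicCompletionMap (L := L) (IsCMField.complexConj L) hw) (placeForm (Matrix.of fun i j : Fin 2 => if i.val + j.val + 1 = 2 then (1 : L) else 0) w.1))) γ | X (Submodule.span 𝒪[w.1.adicCompletion L] (Set.range ((((q.out : ↥(unitaryGroupOfForm (galAdicCompletionMap (L := L) (IsCMField.complexConj L) hw) (placeForm (Matrix.of fun i j : Fin 2 => if i.val + j.val + 1 = 2 then (1 : L) else 0) w.1))) : GL (Fin 2) (w.1.adicCompletion L)) : Matrix (Fin 2) (Fin 2) (w.1.adicCompletion L)))ᵀ))} := by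
    ext q
    simp only [Set.mem_setOf_eq]
    exact ⟨fun h => ⟨h.1, (hXY q h.1).1 h.2⟩, fun h => ⟨h.1, (hXY q h.1).2 h.2⟩⟩
  have hS : {q ∈ MulAction.fixedBy (↥(unitaryGroupOfForm (galAdicCompletionMap (L := L) (IsCMField.complexConj L) hw) (placeForm (Matrix.of fun i j : Fin 2 => if i.val + j.val + 1 = 2 then (1 : L) else 0) w.1)) ⧸
        (glInt 2 (w.1.adicCompletion L)).subgroupOf (unitaryGroupOfForm (galAdicCompletionMap (L := L) (IsCMField.complexConj L) hw) (placeForm (Matrix.of fun i j : Fin 2 => if i.val + j.val + 1 = 2 then (1 : L) else 0) w.1))) γ | X (Submodule.span 𝒪[w.1.adicCompletion L] (Set.range ((((q.out : ↥(unitaryGroupOfForm (galAdicCompletionMap (L := L) (IsCMField.complexConj L) hw) (placeForm (Matrix.of fun i j : Fin 2 => if i.val + j.val + 1 = 2 then (1 : L) else 0) w.1))) : GL (Fin 2) (w.1.adicCompletion L)) : Matrix (Fin 2) (Fin 2) (w.1.adicCompletion L)))ᵀ))}.ncard =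
      {Λ : Submodule 𝒪[w.1.adicCompletion L] (Fin 2 → w.1.adicCompletion L) |
        (∃ u ∈ unitaryGroupOfForm (galAdicCompletionMap (L := L) (IsCMField.complexConj L) hw) (placeForm (Matrix.of fun i j : Fin 2 => if i.val + j.val + 1 = 2 then (1 : L) else 0) w.1),
          Λ = Submodule.span 𝒪[w.1.adicCompletion L] (Set.range ((u : Matrix (Fin 2) (Fin 2) (w.1.adicCompletion L)))ᵀ)) ∧
          Λ.map ((Matrix.toLin' ((((γ : ↥(unitaryGroupOfForm (galAdicCompletionMap (L := L) (IsCMField.complexConj L) hw) (placeForm (Matrix.of fun i j : Fin 2 => if i.val + j.val + 1 = 2 then (1 : L) else 0) w.1))) : GL (Fin 2) (w.1.adicCompletion L)) : Matrix (Fin 2) (Fin 2) (w.1.adicCompletion L)))).restrictScalars 𝒪[w.1.adicCompletion L]) = Λ ∧ X Λ}.ncard :=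
    ncard_sep_fixedBy_unitary_eq_ncard (galAdicCompletionMap (L := L) (IsCMField.complexConj L) hw) (isUnit_placeForm_antidiagOne (E := L) 2 w.1).unit γ X
  rw [hsep, hS]
  congr 1
  ext Λ
  simp only [Set.mem_setOf_eq]
  rw [exists_mem_unitary_span_eq_iff_selfDual_of_nonsplit L 2 _ (IsCMField.complexConj_ne_one L) w hw hunr (antidiagOne_isHermitian L 2)
    (isUnit_placeForm_antidiagOne (E := L) 2 w.1) (unit_placeForm_antidiagOne_mem_glInt (E := L) 2 w.1) Λ]
  exact and_assoc.symm

end Carrier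

/-! ## §2 The depth expansion -/

section Expansion

-- the `L_w`-sized statement and the coset/lattice identities cost ≈ 6× the default ELABORATION budget (no search, no `decide`)
set_option maxHeartbeats 1600000 in
include hw in
/-- **(α) LAYER 2-B: THE DEPTH EXPANSION OF THE FIXED-POINT SUM.**  See the module docstring.  `E` is any additive commutative monoid; `Km` is DATA with the
entrywise membership hypothesis at level `m`; the normal-form elements `xm`, `x i` are pinned by their matrices (`u₁ • 1`, `u₁ • (1 + ϖ_w^i • [[0, δ],[0, 0]])`,
`δ = σO a₀ − a₀`). [cite: Rogawski1990, §4.9 Lemma 4.9.3 p. 56] [cite: LabesseLanglands1979, §2] [cite: Kottwitz1988, §2] -/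
theorem finsum_fixedBy_conj_eq_depthExpansion_at (hunr : Algebra.IsUnramifiedIn (𝓞 L) v.asIdeal)
    (σO : 𝒪[w.1.adicCompletion L] →+* 𝒪[w.1.adicCompletion L])
    (hσO' : ∀ x : 𝒪[w.1.adicCompletion L], ((σO x : 𝒪[w.1.adicCompletion L]) : w.1.adicCompletion L) = galAdicCompletionMap (L := L) (IsCMField.complexConj L) hw x)
    (hσσ : ∀ x, σO (σO x) = x) {a₀ : 𝒪[w.1.adicCompletion L]} (ha₀ : IsUnit (σO a₀ - a₀))
    {γ : ↥(unitaryGroupOfForm (galAdicCompletionMap (L := L) (IsCMField.complexConj L) hw) (placeForm (Matrix.of fun i j : Fin 2 => if i.val + j.val + 1 = 2 then (1 : L) else 0) w.1))} {P : GL (Fin 2) (w.1.adicCompletion L)} {u : Fin 2 → w.1.adicCompletion L}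
    (hP : (((γ : ↥(unitaryGroupOfForm (galAdicCompletionMap (L := L) (IsCMField.complexConj L) hw) (placeForm (Matrix.of fun i j : Fin 2 => if i.val + j.val + 1 = 2 then (1 : L) else 0) w.1))) : GL (Fin 2) (w.1.adicCompletion L)) : Matrix (Fin 2) (Fin 2) (w.1.adicCompletion L)) * P = P * diagonal u) (hu : Function.Injective u)
    (hu1 : ∀ i, galAdicCompletionMap (L := L) (IsCMField.complexConj L) hw (u i) * u i = 1) {n : ℕ}
    (hn : Valued.v (u 0 - u 1) = Valued.v (toPlace v w (HeckeCharacter.uniformizer ↥(maximalRealSubfield L) v : v.adicCompletion ↥(maximalRealSubfield L))) ^ n)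
    {m : ℕ} (hmn : m ≤ n) (Km : Subgroup ↥(unitaryGroupOfForm (galAdicCompletionMap (L := L) (IsCMField.complexConj L) hw) (placeForm (Matrix.of fun i j : Fin 2 => if i.val + j.val + 1 = 2 then (1 : L) else 0) w.1)))
    (hKm : ∀ y : ↥(unitaryGroupOfForm (galAdicCompletionMap (L := L) (IsCMField.complexConj L) hw) (placeForm (Matrix.of fun i j : Fin 2 => if i.val + j.val + 1 = 2 then (1 : L) else 0) w.1)),
      (∀ r s, toPlace v w (HeckeCharacter.uniformizer ↥(maximalRealSubfield L) v : v.adicCompletion ↥(maximalRealSubfield L)) ^ (-(m : ℤ)) *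
        ((((y : ↥(unitaryGroupOfForm (galAdicCompletionMap (L := L) (IsCMField.complexConj L) hw) (placeForm (Matrix.of fun i j : Fin 2 => if i.val + j.val + 1 = 2 then (1 : L) else 0) w.1))) : GL (Fin 2) (w.1.adicCompletion L)) : Matrix (Fin 2) (Fin 2) (w.1.adicCompletion L)) - 1) r s ∈ 𝒪[w.1.adicCompletion L]) → y ∈ Km)
    {E : Type*} [AddCommMonoid E] (φ : ↥(unitaryGroupOfForm (galAdicCompletionMap (L := L) (IsCMField.complexConj L) hw) (placeForm (Matrix.of fun i j : Fin 2 => if i.val + j.val + 1 = 2 then (1 : L) else 0) w.1)) → E)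
    (hφAd : ∀ k ∈ (glInt 2 (w.1.adicCompletion L)).subgroupOf (unitaryGroupOfForm (galAdicCompletionMap (L := L) (IsCMField.complexConj L) hw) (placeForm (Matrix.of fun i j : Fin 2 => if i.val + j.val + 1 = 2 then (1 : L) else 0) w.1)), ∀ x, φ (k * x * k⁻¹) = φ x)
    (hφm : ∀ x, ∀ y ∈ Km, φ (x * y) = φ x) :
    ∃ e : ℕ, e ≤ 1 ∧
      (Even (WithZero.log (Valued.v (twistGram (galAdicCompletionMap (L := L) (IsCMField.complexConj L) hw)
        (placeForm (Matrix.of fun i j : Fin 2 => if i.val + j.val + 1 = 2 then (1 : L) else 0) w.1) P.val 0 0))) ↔ e = 0) ∧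
      ∃ (xm : ↥(unitaryGroupOfForm (galAdicCompletionMap (L := L) (IsCMField.complexConj L) hw) (placeForm (Matrix.of fun i j : Fin 2 => if i.val + j.val + 1 = 2 then (1 : L) else 0) w.1))) (x : ℕ → ↥(unitaryGroupOfForm (galAdicCompletionMap (L := L) (IsCMField.complexConj L) hw) (placeForm (Matrix.of fun i j : Fin 2 => if i.val + j.val + 1 = 2 then (1 : L) else 0) w.1))),
        (((xm : ↥(unitaryGroupOfForm (galAdicCompletionMap (L := L) (IsCMField.complexConj L) hw) (placeForm (Matrix.of fun i j : Fin 2 => if i.val + j.val + 1 = 2 then (1 : L) else 0) w.1))) : GL (Fin 2) (w.1.adicCompletion L)) : Matrix (Fin 2) (Fin 2) (w.1.adicCompletion L)) = u 1 • (1 : Matrix (Fin 2) (Fin 2) (w.1.adicCompletion L)) ∧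
        (∀ i, (((x i : ↥(unitaryGroupOfForm (galAdicCompletionMap (L := L) (IsCMField.complexConj L) hw) (placeForm (Matrix.of fun i j : Fin 2 => if i.val + j.val + 1 = 2 then (1 : L) else 0) w.1))) : GL (Fin 2) (w.1.adicCompletion L)) : Matrix (Fin 2) (Fin 2) (w.1.adicCompletion L)) =
          u 1 • ((1 : Matrix (Fin 2) (Fin 2) (w.1.adicCompletion L)) + toPlace v w (HeckeCharacter.uniformizer ↥(maximalRealSubfield L) v : v.adicCompletion ↥(maximalRealSubfield L)) ^ i • !![0, ((σO a₀ - a₀ : 𝒪[w.1.adicCompletion L]) : w.1.adicCompletion L); 0, 0])) ∧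
        ∑ᶠ q ∈ MulAction.fixedBy (↥(unitaryGroupOfForm (galAdicCompletionMap (L := L) (IsCMField.complexConj L) hw) (placeForm (Matrix.of fun i j : Fin 2 => if i.val + j.val + 1 = 2 then (1 : L) else 0) w.1)) ⧸
        (glInt 2 (w.1.adicCompletion L)).subgroupOf (unitaryGroupOfForm (galAdicCompletionMap (L := L) (IsCMField.complexConj L) hw) (placeForm (Matrix.of fun i j : Fin 2 => if i.val + j.val + 1 = 2 then (1 : L) else 0) w.1))) γ, φ (q.out⁻¹ * γ * q.out) =
          (∑ j ∈ (range (n + 1)).filter (fun j => j % 2 = e ∧ j + m ≤ n), (if j = 0 then 1 else Nat.card (𝓞 ↥(maximalRealSubfield L) ⧸ v.asIdeal) ^ (j - 1) * (Nat.card (𝓞 ↥(maximalRealSubfield L) ⧸ v.asIdeal) + 1))) • φ xm +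
          ∑ i ∈ range m, (if i ≤ n ∧ (n - i) % 2 = e then (if (n - i) = 0 then 1 else Nat.card (𝓞 ↥(maximalRealSubfield L) ⧸ v.asIdeal) ^ ((n - i) - 1) * (Nat.card (𝓞 ↥(maximalRealSubfield L) ⧸ v.asIdeal) + 1)) else 0) • φ (x i) := by
  classical
  -- scalars at `w`
  have hϖ0 := toPlace_uniformizer_ne_zero L v w hunr
  have hϖv := Liu2021.LemD1IndexedNonVacuityInertCofinite.valued_toPlace_uniformizer_of_isUnramifiedIn L v hunr w
  have hϖ : IsUniformizingElement (toPlace v w (HeckeCharacter.uniformizer ↥(maximalRealSubfield L) v : v.adicCompletion ↥(maximalRealSubfield L))) := isUniformizingElement_of_v_eq hϖv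
  have hσϖ := galAdicCompletionMap_toPlace_self L v w hw (HeckeCharacter.uniformizer ↥(maximalRealSubfield L) v : v.adicCompletion _)
  have hval : ∀ i, valuation (w.1.adicCompletion L) (u i) = 1 := fun i => valuation_eq_one_of_galAdicCompletionMap_mul_self L v w hw (hu1 i)
  have hN : valuation (w.1.adicCompletion L) (u 0 - u 1) = valuation (w.1.adicCompletion L) (toPlace v w (HeckeCharacter.uniformizer ↥(maximalRealSubfield L) v : v.adicCompletion ↥(maximalRealSubfield L)) ^ n) := by
    rw [← v_eq_iff_valuation_eq, hn, map_pow]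
  have hu1O : u 1 ∈ 𝒪[w.1.adicCompletion L] := (Valuation.mem_integer_iff _ _).2 (hval 1).le
  have hσδ := galAdicCompletionMap_delta_eq_neg L v w hw σO hσO' hσσ a₀
  have hδO : ((σO a₀ - a₀ : 𝒪[w.1.adicCompletion L]) : w.1.adicCompletion L) ∈ 𝒪[w.1.adicCompletion L] := (σO a₀ - a₀).2
  have hJ := placeForm_antidiagTwo_eq_swap_lit L v w
  -- the normal-form elements
  obtain ⟨xm, x, -, -, hxm, hxm', hx, hx'⟩ :=
    exists_unitary_normalForm_elements (galAdicCompletionMap (L := L) (IsCMField.complexConj L) hw) _ hJ (hu1 1) (hval 1) hσϖ hϖ.mem hσδ hδO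
  -- the parity bit and the level-`m` count
  obtain ⟨e, he1, hpar, hcm⟩ := exists_ncard_selfDualStable_antidiagTwo_level_eq_sum_at L v w hw hunr (γ := (γ : GL (Fin 2) (w.1.adicCompletion L))) γ.2 hP hu hu1 hN m
  refine ⟨e, he1, hpar, xm, x, hxm, hx, ?_⟩
  -- the depth predicate of a coset and its bookkeeping
  have hanti : ∀ q : ↥(unitaryGroupOfForm (galAdicCompletionMap (L := L) (IsCMField.complexConj L) hw) (placeForm (Matrix.of fun i j : Fin 2 => if i.val + j.val + 1 = 2 then (1 : L) else 0) w.1)) ⧸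
        (glInt 2 (w.1.adicCompletion L)).subgroupOf (unitaryGroupOfForm (galAdicCompletionMap (L := L) (IsCMField.complexConj L) hw) (placeForm (Matrix.of fun i j : Fin 2 => if i.val + j.val + 1 = 2 then (1 : L) else 0) w.1)), ∀ i j : ℕ, i ≤ j →
      (∀ r s, toPlace v w (HeckeCharacter.uniformizer ↥(maximalRealSubfield L) v : v.adicCompletion ↥(maximalRealSubfield L)) ^ (-((j : ℕ) : ℤ)) *
            ((((q.out⁻¹ * γ * q.out : ↥(unitaryGroupOfForm (galAdicCompletionMap (L := L) (IsCMField.complexConj L) hw) (placeForm (Matrix.of fun i j : Fin 2 => if i.val + j.val + 1 = 2 then (1 : L) else 0) w.1))) : GL (Fin 2) (w.1.adicCompletion L)) : Matrix (Fin 2) (Fin 2) (w.1.adicCompletion L)) - u 1 • (1 : Matrix (Fin 2) (Fin 2) (w.1.adicCompletion L))) r s ∈ 𝒪[w.1.adicCompletion L]) →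
      (∀ r s, toPlace v w (HeckeCharacter.uniformizer ↥(maximalRealSubfield L) v : v.adicCompletion ↥(maximalRealSubfield L)) ^ (-((i : ℕ) : ℤ)) *
            ((((q.out⁻¹ * γ * q.out : ↥(unitaryGroupOfForm (galAdicCompletionMap (L := L) (IsCMField.complexConj L) hw) (placeForm (Matrix.of fun i j : Fin 2 => if i.val + j.val + 1 = 2 then (1 : L) else 0) w.1))) : GL (Fin 2) (w.1.adicCompletion L)) : Matrix (Fin 2) (Fin 2) (w.1.adicCompletion L)) - u 1 • (1 : Matrix (Fin 2) (Fin 2) (w.1.adicCompletion L))) r s ∈ 𝒪[w.1.adicCompletion L]) :=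
    fun q i j hij h => depthPred_anti hϖ _ hij h
  have h0 : ∀ q ∈ MulAction.fixedBy (↥(unitaryGroupOfForm (galAdicCompletionMap (L := L) (IsCMField.complexConj L) hw) (placeForm (Matrix.of fun i j : Fin 2 => if i.val + j.val + 1 = 2 then (1 : L) else 0) w.1)) ⧸
        (glInt 2 (w.1.adicCompletion L)).subgroupOf (unitaryGroupOfForm (galAdicCompletionMap (L := L) (IsCMField.complexConj L) hw) (placeForm (Matrix.of fun i j : Fin 2 => if i.val + j.val + 1 = 2 then (1 : L) else 0) w.1))) γ,
      (∀ r s, toPlace v w (HeckeCharacter.uniformizer ↥(maximalRealSubfield L) v : v.adicCompletion ↥(maximalRealSubfield L)) ^ (-((0 : ℕ) : ℤ)) *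
            ((((q.out⁻¹ * γ * q.out : ↥(unitaryGroupOfForm (galAdicCompletionMap (L := L) (IsCMField.complexConj L) hw) (placeForm (Matrix.of fun i j : Fin 2 => if i.val + j.val + 1 = 2 then (1 : L) else 0) w.1))) : GL (Fin 2) (w.1.adicCompletion L)) : Matrix (Fin 2) (Fin 2) (w.1.adicCompletion L)) - u 1 • (1 : Matrix (Fin 2) (Fin 2) (w.1.adicCompletion L))) r s ∈ 𝒪[w.1.adicCompletion L]) := fun q hq r s => by
    have hkO := ((mem_glInt_iff _).1 (coe_conj_out_mem_glInt_of_mem_fixedBy L v w hw γ q hq)).1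
    simpa only [Nat.cast_zero, neg_zero, zpow_zero] using depthPred_zero hkO hu1O r s
  have hfin := finite_fixedBy_quotient_glInt_at L v w hw hunr hP hu hu1 hN
  -- THE VALUE LAW at every fixed coset
  have hvalue : ∀ q ∈ MulAction.fixedBy (↥(unitaryGroupOfForm (galAdicCompletionMap (L := L) (IsCMField.complexConj L) hw) (placeForm (Matrix.of fun i j : Fin 2 => if i.val + j.val + 1 = 2 then (1 : L) else 0) w.1)) ⧸
        (glInt 2 (w.1.adicCompletion L)).subgroupOf (unitaryGroupOfForm (galAdicCompletionMap (L := L) (IsCMField.complexConj L) hw) (placeForm (Matrix.of fun i j : Fin 2 => if i.val + j.val + 1 = 2 then (1 : L) else 0) w.1))) γ,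
      φ (q.out⁻¹ * γ * q.out) =
        (fun j : ℕ => if j = m then φ xm else φ (x j))
          (min (Nat.findGreatest (fun i => (∀ r s, toPlace v w (HeckeCharacter.uniformizer ↥(maximalRealSubfield L) v : v.adicCompletion ↥(maximalRealSubfield L)) ^ (-((i : ℕ) : ℤ)) *
            ((((q.out⁻¹ * γ * q.out : ↥(unitaryGroupOfForm (galAdicCompletionMap (L := L) (IsCMField.complexConj L) hw) (placeForm (Matrix.of fun i j : Fin 2 => if i.val + j.val + 1 = 2 then (1 : L) else 0) w.1))) : GL (Fin 2) (w.1.adicCompletion L)) : Matrix (Fin 2) (Fin 2) (w.1.adicCompletion L)) - u 1 • (1 : Matrix (Fin 2) (Fin 2) (w.1.adicCompletion L))) r s ∈ 𝒪[w.1.adicCompletion L])) n) m) := by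
    intro q hq
    have hkI := coe_conj_out_mem_glInt_of_mem_fixedBy L v w hw γ q hq
    have hkO := ((mem_glInt_iff _).1 hkI).1
    have hac : ((((q.out⁻¹ * γ * q.out : ↥(unitaryGroupOfForm (galAdicCompletionMap (L := L) (IsCMField.complexConj L) hw) (placeForm (Matrix.of fun i j : Fin 2 => if i.val + j.val + 1 = 2 then (1 : L) else 0) w.1))) : GL (Fin 2) (w.1.adicCompletion L)) : Matrix (Fin 2) (Fin 2) (w.1.adicCompletion L)) - u 0 • 1) * ((((q.out⁻¹ * γ * q.out : ↥(unitaryGroupOfForm (galAdicCompletionMap (L := L) (IsCMField.complexConj L) hw) (placeForm (Matrix.of fun i j : Fin 2 => if i.val + j.val + 1 = 2 then (1 : L) else 0) w.1))) : GL (Fin 2) (w.1.adicCompletion L)) : Matrix (Fin 2) (Fin 2) (w.1.adicCompletion L)) - u 1 • 1) = 0 := by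
      rw [Subgroup.coe_mul, Subgroup.coe_mul, Subgroup.coe_inv]
      exact sub_smul_mul_sub_smul_eq_zero_of_conj_diagonal (γ : GL (Fin 2) (w.1.adicCompletion L)) P (q.out : GL (Fin 2) (w.1.adicCompletion L)) hP
    by_cases hmd : m ≤ Nat.findGreatest (fun i => (∀ r s, toPlace v w (HeckeCharacter.uniformizer ↥(maximalRealSubfield L) v : v.adicCompletion ↥(maximalRealSubfield L)) ^ (-((i : ℕ) : ℤ)) *
            ((((q.out⁻¹ * γ * q.out : ↥(unitaryGroupOfForm (galAdicCompletionMap (L := L) (IsCMField.complexConj L) hw) (placeForm (Matrix.of fun i j : Fin 2 => if i.val + j.val + 1 = 2 then (1 : L) else 0) w.1))) : GL (Fin 2) (w.1.adicCompletion L)) : Matrix (Fin 2) (Fin 2) (w.1.adicCompletion L)) - u 1 • (1 : Matrix (Fin 2) (Fin 2) (w.1.adicCompletion L))) r s ∈ 𝒪[w.1.adicCompletion L])) n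
    · simp only [min_eq_right hmd, if_true]
      exact apply_eq_apply_scalar_of_depth_le (galAdicCompletionMap (L := L) (IsCMField.complexConj L) hw) _ hJ (hval 1) m Km hKm φ hφm xm hxm' _
        ((le_findGreatest_iff_of_anti (hanti q) (h0 q hq) hmn).1 hmd)
    · have hlt : Nat.findGreatest (fun i => (∀ r s, toPlace v w (HeckeCharacter.uniformizer ↥(maximalRealSubfield L) v : v.adicCompletion ↥(maximalRealSubfield L)) ^ (-((i : ℕ) : ℤ)) *
            ((((q.out⁻¹ * γ * q.out : ↥(unitaryGroupOfForm (galAdicCompletionMap (L := L) (IsCMField.complexConj L) hw) (placeForm (Matrix.of fun i j : Fin 2 => if i.val + j.val + 1 = 2 then (1 : L) else 0) w.1))) : GL (Fin 2) (w.1.adicCompletion L)) : Matrix (Fin 2) (Fin 2) (w.1.adicCompletion L)) - u 1 • (1 : Matrix (Fin 2) (Fin 2) (w.1.adicCompletion L))) r s ∈ 𝒪[w.1.adicCompletion L])) n < m := not_le.1 hmd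
      simp only [min_eq_left hlt.le, if_neg hlt.ne]
      obtain ⟨hki, hki'⟩ := (findGreatest_eq_iff_of_anti (hanti q) (h0 q hq) (lt_of_lt_of_le hlt hmn)).1 rfl
      rw [Nat.cast_succ] at hki'
      exact apply_eq_apply_normalForm_of_depth_eq (galAdicCompletionMap (L := L) (IsCMField.complexConj L) hw) hϖ hσϖ σO hσO' hσσ _ hJ ha₀ (hu1 0) (hu1 1) (hval 0) (hval 1) hN hlt hmn Km hKm φ
        (fun κ hκ y => hφAd κ ((Subgroup.mem_subgroupOf).2 hκ) y) hφm x hx' _ hkO hac hki hki'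
  -- the level-`m` count and the exact-depth counts, read as lattice counts (★ L2a + docking) and evaluated (★ FILES 4–5)
  have hsetm : {q ∈ MulAction.fixedBy (↥(unitaryGroupOfForm (galAdicCompletionMap (L := L) (IsCMField.complexConj L) hw) (placeForm (Matrix.of fun i j : Fin 2 => if i.val + j.val + 1 = 2 then (1 : L) else 0) w.1)) ⧸
        (glInt 2 (w.1.adicCompletion L)).subgroupOf (unitaryGroupOfForm (galAdicCompletionMap (L := L) (IsCMField.complexConj L) hw) (placeForm (Matrix.of fun i j : Fin 2 => if i.val + j.val + 1 = 2 then (1 : L) else 0) w.1))) γ | m ≤ Nat.findGreatest (fun i => (∀ r s, toPlace v w (HeckeCharacter.uniformizer ↥(maximalRealSubfield L) v : v.adicCompletion ↥(maximalRealSubfield L)) ^ (-((i : ℕ) : ℤ)) *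
            ((((q.out⁻¹ * γ * q.out : ↥(unitaryGroupOfForm (galAdicCompletionMap (L := L) (IsCMField.complexConj L) hw) (placeForm (Matrix.of fun i j : Fin 2 => if i.val + j.val + 1 = 2 then (1 : L) else 0) w.1))) : GL (Fin 2) (w.1.adicCompletion L)) : Matrix (Fin 2) (Fin 2) (w.1.adicCompletion L)) - u 1 • (1 : Matrix (Fin 2) (Fin 2) (w.1.adicCompletion L))) r s ∈ 𝒪[w.1.adicCompletion L])) n}.ncard =
      ∑ j ∈ (range (n + 1)).filter (fun j => j % 2 = e ∧ j + m ≤ n), (if j = 0 then 1 else Nat.card (𝓞 ↥(maximalRealSubfield L) ⧸ v.asIdeal) ^ (j - 1) * (Nat.card (𝓞 ↥(maximalRealSubfield L) ⧸ v.asIdeal) + 1)) := by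
    rw [← hcm]
    refine ncard_sep_fixedBy_eq_ncard_selfDualStable_sep_at L v w hw hunr γ _ _ fun q hq => ?_
    rw [le_findGreatest_iff_of_anti (hanti q) (h0 q hq) hmn, map_sub_smul_one_le_iff_forall_mem hϖ0 (γ : GL (Fin 2) (w.1.adicCompletion L)) (q.out : GL (Fin 2) (w.1.adicCompletion L)) (u 1) m,
      Subgroup.coe_mul, Subgroup.coe_mul, Subgroup.coe_inv]
  have hseti : ∀ i, i < m → {q ∈ MulAction.fixedBy (↥(unitaryGroupOfForm (galAdicCompletionMap (L := L) (IsCMField.complexConj L) hw) (placeForm (Matrix.of fun i j : Fin 2 => if i.val + j.val + 1 = 2 then (1 : L) else 0) w.1)) ⧸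
        (glInt 2 (w.1.adicCompletion L)).subgroupOf (unitaryGroupOfForm (galAdicCompletionMap (L := L) (IsCMField.complexConj L) hw) (placeForm (Matrix.of fun i j : Fin 2 => if i.val + j.val + 1 = 2 then (1 : L) else 0) w.1))) γ | Nat.findGreatest (fun i => (∀ r s, toPlace v w (HeckeCharacter.uniformizer ↥(maximalRealSubfield L) v : v.adicCompletion ↥(maximalRealSubfield L)) ^ (-((i : ℕ) : ℤ)) *
            ((((q.out⁻¹ * γ * q.out : ↥(unitaryGroupOfForm (galAdicCompletionMap (L := L) (IsCMField.complexConj L) hw) (placeForm (Matrix.of fun i j : Fin 2 => if i.val + j.val + 1 = 2 then (1 : L) else 0) w.1))) : GL (Fin 2) (w.1.adicCompletion L)) : Matrix (Fin 2) (Fin 2) (w.1.adicCompletion L)) - u 1 • (1 : Matrix (Fin 2) (Fin 2) (w.1.adicCompletion L))) r s ∈ 𝒪[w.1.adicCompletion L])) n = i}.ncard =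
      (if i ≤ n ∧ (n - i) % 2 = e then (if (n - i) = 0 then 1 else Nat.card (𝓞 ↥(maximalRealSubfield L) ⧸ v.asIdeal) ^ ((n - i) - 1) * (Nat.card (𝓞 ↥(maximalRealSubfield L) ⧸ v.asIdeal) + 1)) else 0) := by
    intro i him
    obtain ⟨e', he1', hpar', hci⟩ :=
      exists_ncard_selfDualStable_antidiagTwo_depth_eq_ite_at L v w hw hunr (γ := (γ : GL (Fin 2) (w.1.adicCompletion L))) γ.2 hP hu hu1 hN i
    rw [eq_of_iff_eq_zero_of_le_one he1 he1' hpar hpar'] at hci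
    rw [← hci]
    refine ncard_sep_fixedBy_eq_ncard_selfDualStable_sep_at L v w hw hunr γ _ _ fun q hq => ?_
    rw [findGreatest_eq_iff_of_anti (hanti q) (h0 q hq) (lt_of_lt_of_le him hmn),
      map_sub_smul_one_le_iff_forall_mem hϖ0 (γ : GL (Fin 2) (w.1.adicCompletion L)) (q.out : GL (Fin 2) (w.1.adicCompletion L)) (u 1) i,
      map_sub_smul_one_le_iff_forall_mem hϖ0 (γ : GL (Fin 2) (w.1.adicCompletion L)) (q.out : GL (Fin 2) (w.1.adicCompletion L)) (u 1) (i + 1),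
      Subgroup.coe_mul, Subgroup.coe_mul, Subgroup.coe_inv]
  -- ★ (α) L1: regroup the fixed-point sum by `min (d q) m`, then substitute the counts
  rw [finsum_mem_eq_ncard_smul_add_sum_ncard_smul hfin (fun q => φ (q.out⁻¹ * γ * q.out))
    (fun q => Nat.findGreatest (fun i => (∀ r s, toPlace v w (HeckeCharacter.uniformizer ↥(maximalRealSubfield L) v : v.adicCompletion ↥(maximalRealSubfield L)) ^ (-((i : ℕ) : ℤ)) *
            ((((q.out⁻¹ * γ * q.out : ↥(unitaryGroupOfForm (galAdicCompletionMap (L := L) (IsCMField.complexConj L) hw) (placeForm (Matrix.of fun i j : Fin 2 => if i.val + j.val + 1 = 2 then (1 : L) else 0) w.1))) : GL (Fin 2) (w.1.adicCompletion L)) : Matrix (Fin 2) (Fin 2) (w.1.adicCompletion L)) - u 1 • (1 : Matrix (Fin 2) (Fin 2) (w.1.adicCompletion L))) r s ∈ 𝒪[w.1.adicCompletion L])) n) m (fun j : ℕ => if j = m then φ xm else φ (x j)) hvalue,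
    if_pos rfl, hsetm]
  congr 1
  refine Finset.sum_congr rfl fun i hi => ?_
  have him : i < m := Finset.mem_range.1 hi
  rw [if_neg him.ne, hseti i him]

end Expansion

end Literature.NumberTheory.Automorphic.UnitaryGroup

end
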